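import Summits.BirchSwinnertonDyer.Rank1Residual.Additive.GordCycLeadingTerm
import Summits.BirchSwinnertonDyer.Rank1Residual.AdditivePotMult.Descent
import Literature.NumberTheory.EllipticCurves.Delbourgo1998.RankZeroLeadingTermExactPotMult
import HarnessLib

/-!
# The LOWER half `ord_p #Ш_an ≤ ord_p #Ш` at an additive prime of type (M) or (G)-ordinary, rank `0`:
# ONE typed cyclotomic input — "`L(E,1)/Ω_E` divides the constant term of EVERY element of
# `char X(E/ℚ_∞)`" (Delbourgo's Main Conjecture, MAIN-CONJECTURE direction, at `T = 0`) — and its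
# kernel reduction to Miller's currency (cell `b2b-bsdres`, team n1011, seat n1011-p18, sub-target T-N10b)

HONEST FRAMING (cell `b2b-bsdres`, run/shared/lean/b2b/bsd-rank1-residual/, verbatim in every
file): the goal of the cell is to DELETE the COMBINATION-SHAPED residual classes of the
Birch–Swinnerton-Dyer formula for ALL analytic-rank `≤ 1` elliptic curves over `ℚ` — "full BSD
formula for every rank `≤ 1` curve in class `C`" assembled STRICTLY from published theorems — so
that the rank-`≤ 1` remainder becomes exactly the CONSTRUCTION-SHAPED classes, which are TYPED
(missing-input `Prop`s), NOT attempted. This is not "finishing BSD". Team n1011 (RESIDUAL-MAP §I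
N10/N11: the additive block), sub-target T-N10b of HOME/cells/n1011/OWNERS.md: research route; no
claim beyond the stated classes; N10 stays CONSTRUCTION / NEEDS; labels unchanged; nothing booked.
Two definitions (typed inputs, nothing asserted) and theorems; every published input is an explicit
named-fact hypothesis of the tree; no `_holds`.

## What and why

RESIDUAL-MAP §I **N10** (X3 ∪ X4, `r = 0`, loci (M) = additive potentially multiplicative and
(G-ord) = additive potentially good ordinary): the UPPER half `ord_p #Ш ≤ ord_p #Ш_an` is a kernel
theorem (seats additive-p1/p2/p4; in Iwasawa currency: additive-p2's typed input
`CycLeadingTermAt W p` = "SOME `g ∈ char_Λ X(E/ℚ_∞)` has `g(0) = u · L(E,1)/Ω_E`, `u ∈ ℤ_p^×`" —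
the divisibility (Kato, "`⊇`") direction of Delbourgo's Main Conjecture at `T = 0` — together with
Delbourgo 1998 Prop. 4 in its divisibility transcription `prop4_rankZero_pow_dvd_constantCoeff`,
file `Additive/GordCycLeadingTerm.lean`). What is missing is the LOWER half, so far typed only in
Miller's currency (`Typed.MissingLowerBoundAt W p`: `ord_p #Ш_an ≤ ord_p #Ш`). This file types it
in IWASAWA currency and proves the reduction:

* `CycLeadingTermDvdAt W p` (TYPED, §0): for the cyclotomic `ℤ_p`-extension and EVERY Pontryagin-dual
  datum `D` of `Sel_{p^∞}(E/ℚ_∞)`, EVERY `g ∈ char_Λ X(E/ℚ_∞)` has `g(0) = z · q` with `z ∈ ℤ_p` and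
  `q = L(E,1)/Ω_E ∈ ℚ`. This is the MAIN-CONJECTURE ("`⊆`", Skinner–Urban) direction of Delbourgo's
  Main Conjecture (G)/(M) [Compositio 113 (1998) p. 151: "`ι(T) G_E(T) = ℓ_p(E) ∫_{g∈Γ} (1+T)^{x_p(g)} dμ_E`
  for some `ι ∈ Λ^×`", `ℓ_p(E) ∈ ℕ` (p. 151)] SPECIALISED AT `T = 0`: every element of the
  characteristic ideal is a multiple of `G_E`, and `G_E(0) = ι(0)⁻¹ · ℓ_p(E) · ∫ dμ_E` is divisible
  by `∫ dμ_E`, the value of the measure at the trivial character (Thm. 1, p. 131: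
  `(p^m/α_p^m)·(G(ψε)/G(ε))·L^{(G)}_p(ψε(p))·L(E,ψ̄,1)/Ω^{±}_E`, a multiplier of valuation `≥ 0`
  times `L(E,1)/Ω_E` at `ψ = 1`). Whatever normalisation of the interpolation one reads, extra
  factors only ADD valuation, so the typed statement is implied by the conjecture as printed; it is
  the exact mirror of `CycLeadingTermAt`, and `CycLeadingTermAt ∧ CycLeadingTermDvdAt` says "the
  generator has constant term `unit · L(E,1)/Ω_E`", i.e. the Main Conjecture at `T = 0`. NOT in print
  as a theorem at any additive prime (the located gap of N10: Skinner–Urban, Invent. Math. 195 (2014)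
  Thm. 3.6.4 needs trivial tame character and `p ∤ N`; Wan, Forum Math. Sigma 3 (2015) needs `p`
  unramified — harvest-2 E65, HOME/INBOX 2026-08-21). Nothing asserted.
* `ExactLeadingTermAt W p` (TYPED, §0): Delbourgo Prop. 4 with `#H¹(ℚ_{∞,p}/ℚ_p, E(ℚ_{∞,p}))(p) = 1`:
  SOME `g ∈ char_Λ X(E/ℚ_∞)` has `g(0) · #E(ℚ)² = u · #Ш(E)(p) · ∏_{ν≠p} c_ν`, `u ∈ ℤ_p^×`. On the
  (M) locus this is a THEOREM (§2, from the named fact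
  `Delbourgo1998.prop4_rankZero_constantCoeff_eq_unit_mul_of_potMult` = Prop. 4 (p. 144) + §2.2
  Lemma (ii) (p. 139), which prints `#H¹(…)(p) = 1` under (M)); on the (G)-ordinary locus it is kept
  as an INPUT: Lemma (i) prints `#H¹(p) = #F(𝔽_p)(p) · #R(E(ℚ_p))(p)`, whose literal reading would
  make it a per-pair condition ("the (G)-twist is non-anomalous and `p ∤ #R`") and whose corrected
  reading (READING NOTE of `Additive/GordCycLeadingTerm.lean`: the inertia-twisted action makes the
  `p`-part trivial) makes it automatic on the whole (G)-cell for `p ≥ 5` — neither reading is typed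
  as a fact here.
* CONSUMERS: §1 class-agnostic core `shaAn_le_shaOrder_of_cycLeadingTermDvd_of_exact`
  (`CycLeadingTermDvdAt` + `ExactLeadingTermAt` + GZK + modularity, `r_an = 0` ⟹
  `#Ш_an = q ∈ ℚ` with **`ord_p q + ord_p c_p(E) ≤ ord_p #Ш(E)`**, torsion and the Tamagawa numbers
  away from `p` cancelling exactly) and `missingLowerBoundAt_of_cycLeadingTermDvd_of_exact`;
  §2 the (M) locus: `Typed.MissingLowerBoundAt W p` on X4(M) and X3♯(M) at EVERY odd `p` (`3`
  included) in analytic rank `0` from `CycLeadingTermDvdAt W p` ALONE (no image, Tamagawa, Manin or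
  certificate hypothesis) — `ClassX4M.missingLowerBoundAt_rankZero_of_cycLeadingTermDvd`,
  `ClassX3M.…`; §3 the (G)-ordinary locus: the same given `ExactLeadingTermAt W p`
  (`ClassX4Gord.…`, `ClassX3Gord.…`). The sequel `Additive/CycLeadingTermDvdConverse.lean` proves
  the CONVERSE (lower half in Miller's currency + Prop. 4 divisibility + `p ∤ c_p` ⟹ the typed
  input), the iff on the (M) locus, and `BSD(E,p)` on the (M) locus in rank `0` from BOTH `T = 0`
  directions (`CycLeadingTermAt ∧ CycLeadingTermDvdAt`).

So on N10's (M) rows (RESIDUAL-MAP: X4(M) CORE 247 ‖ 1 006, X3♯(M) 298 ‖ 517 window pairs; sweep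
S-b `r = 0`: X4(M) 92 417 + X3(M) 5 168 — numbers of record, not re-derived here) the class-level
missing input is, in the kernel, the `T = 0` main-conjecture divisibility `CycLeadingTermDvdAt W p`
(and EXACTLY that, by the sequel's iff); on the (G-ord) rows it is that AND the exactness of
Prop. 4's `H¹`-factor. N10 stays CONSTRUCTION / NEEDS; nothing is booked.

References: D. Delbourgo, Compositio Math. 113 (1998) 123–154, Thm. 1 (p. 131), §2.2 Lemma (pp.
139–140), Thm. 3 (p. 143), Prop. 4 (p. 144), Main Conjecture (p. 151) [Delbourgo1998]; R. Greenberg,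
LNM 1716 (1999) §1 [GreenbergLNM1716]; R. L. Miller, LMS J. Comput. Math. 14 (2011) Def. 1.1
[Miller2011LMS]; C. Skinner, E. Urban, Invent. Math. 195 (2014) Thm. 3.6.4 [SkinnerUrban2014];
X. Wan, Forum Math. Sigma 3 (2015) e18 §1.1 [Wan2015].
-/

noncomputable section

open scoped Classical NumberField

open WeierstrassCurve NumberField Literature.NumberTheory.EllipticCurves
  Literature.NumberTheory.EllipticCurves.Rank1Residual
  Literature.NumberTheory.EllipticCurves.Rank1Residual.Typed
  IsDedekindDomain Rat.HeightOneSpectrum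

namespace Summit.BirchSwinnertonDyer.Rank1Residual.Additive

/-! ### §0 The typed inputs -/

/-- **The main-conjecture divisibility at `T = 0`, TYPED** (the LOWER-half missing input of N10 in
Iwasawa currency). For the globally minimal `W = E` and the prime `p`: for the cyclotomic
`ℤ_p`-extension `κ` of `ℚ` with a topological generator `γ` matching the cyclotomic variable and EVERY
Pontryagin-dual datum `D` of the classical Selmer group `Sel_{p^∞}(E/ℚ_∞)` (tree `SelmerDualData`,
Delbourgo's `X_∞`), EVERY element `g` of the characteristic ideal `char_Λ X(E/ℚ_∞)` has constant term
`g(0) = z · q` with `z ∈ ℤ_p` and `q = L(E,1)/Ω_E ∈ ℚ` (`L(E,1) = q · Ω_E`) — "`L(E,1)/Ω_E` divides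
`g(0)` in `ℤ_p`". Shape = Delbourgo 1998 Main Conjecture (G)/(M) (p. 151), MAIN-CONJECTURE
direction, at `T = 0` (module docstring: robust to the normalisation of the interpolation). The
mirror of `CycLeadingTermAt` (additive-p2). NOT in print as a theorem at any additive prime. A
predicate on `(W, p)`; its universal closure over any locus is NOT asserted.
[cite: Delbourgo1998, Main Conjecture (p. 151) (shape only; nothing asserted)] -/
def CycLeadingTermDvdAt (W : WeierstrassCurve ℚ) (p : ℕ) [Fact p.Prime] : Prop :=
  ∀ (κ : ZpExtension ℚ p) (γ : Field.absoluteGaloisGroup ℚ),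
    κ.IsCyclotomic → κ.IsTopGenerator γ → IsCyclotomicVariable p γ →
    ∀ D : W.SelmerDualData κ γ, ∀ g ∈ D.charIdeal, ∃ z : ℤ_[p], ∃ q : ℚ,
      W.entireLFunction 1 = (q : ℂ) * (W.realPeriodRat : ℂ) ∧
      ((PowerSeries.constantCoeff g : ℤ_[p]) : ℚ_[p]) = (z : ℚ_[p]) * (q : ℚ_[p])

/-- Unfolding lemma for `CycLeadingTermDvdAt` (to apply the predicate as a function). -/
theorem cycLeadingTermDvdAt_iff (W : WeierstrassCurve ℚ) (p : ℕ) [Fact p.Prime] :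
    CycLeadingTermDvdAt W p ↔
      ∀ (κ : ZpExtension ℚ p) (γ : Field.absoluteGaloisGroup ℚ),
        κ.IsCyclotomic → κ.IsTopGenerator γ → IsCyclotomicVariable p γ →
        ∀ D : W.SelmerDualData κ γ, ∀ g ∈ D.charIdeal, ∃ z : ℤ_[p], ∃ q : ℚ,
          W.entireLFunction 1 = (q : ℂ) * (W.realPeriodRat : ℂ) ∧
          ((PowerSeries.constantCoeff g : ℤ_[p]) : ℚ_[p]) = (z : ℚ_[p]) * (q : ℚ_[p]) :=
  Iff.rfl

/-- **Exactness of the rank-zero algebraic leading term, TYPED** (Delbourgo 1998 Prop. 4 with the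
`H¹`-factor of `p`-part `1`). For the globally minimal `W = E` and the prime `p`: for the cyclotomic
`ℤ_p`-extension `κ` with topological generator `γ` and every Pontryagin-dual datum `D` of
`Sel_{p^∞}(E/ℚ_∞)`, SOME `g ∈ char_Λ X(E/ℚ_∞)` has `g(0) · #E(ℚ)² = u · #Ш(E)(p) · ∏_{ν≠p} c_ν` in
`ℤ_p` with `u ∈ ℤ_p^×` (`#E(ℚ) = Nat.card` of the rational points — meaningful when finite, i.e. in
rank `0`; `∏_{ν≠p} c_ν` as in Delbourgo's named facts). On the (M) locus in analytic rank `0` it is a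
theorem (`exactLeadingTermAt_of_potMult`, from Prop. 4 + §2.2 Lemma (ii)); on the (G)-ordinary locus
it is an input (module docstring: the `H¹`-factor of Lemma (i)). A predicate on `(W, p)`; nothing
asserted. [cite: Delbourgo1998, Prop. 4 (p. 144) (shape only; nothing asserted)] -/
def ExactLeadingTermAt (W : WeierstrassCurve ℚ) (p : ℕ) [Fact p.Prime] : Prop :=
  ∀ (κ : ZpExtension ℚ p) (γ : Field.absoluteGaloisGroup ℚ),
    κ.IsCyclotomic → κ.IsTopGenerator γ →
    ∀ D : W.SelmerDualData κ γ, ∃ g ∈ D.charIdeal, ∃ u : ℤ_[p]ˣ,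
      PowerSeries.constantCoeff g * ((Nat.card W.toAffine.Point : ℕ) : ℤ_[p]) ^ 2 =
        (u : ℤ_[p]) * ((Nat.card (AddCommGroup.primaryComponent W.sha p) : ℕ) : ℤ_[p]) *
          ((∏ᶠ v : HeightOneSpectrum (𝓞 ℚ),
              if (p : 𝓞 ℚ) ∈ v.asIdeal then 1 else W.tamagawaNumberAt v : ℕ) : ℤ_[p])

/-- Unfolding lemma for `ExactLeadingTermAt`. -/
theorem exactLeadingTermAt_iff (W : WeierstrassCurve ℚ) (p : ℕ) [Fact p.Prime] :
    ExactLeadingTermAt W p ↔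
      ∀ (κ : ZpExtension ℚ p) (γ : Field.absoluteGaloisGroup ℚ),
        κ.IsCyclotomic → κ.IsTopGenerator γ →
        ∀ D : W.SelmerDualData κ γ, ∃ g ∈ D.charIdeal, ∃ u : ℤ_[p]ˣ,
          PowerSeries.constantCoeff g * ((Nat.card W.toAffine.Point : ℕ) : ℤ_[p]) ^ 2 =
            (u : ℤ_[p]) * ((Nat.card (AddCommGroup.primaryComponent W.sha p) : ℕ) : ℤ_[p]) *
              ((∏ᶠ v : HeightOneSpectrum (𝓞 ℚ),
                  if (p : 𝓞 ℚ) ∈ v.asIdeal then 1 else W.tamagawaNumberAt v : ℕ) : ℤ_[p]) :=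
  Iff.rfl

variable (W : WeierstrassCurve ℚ) [W.IsElliptic] [W.IsGloballyMinimal] (p : ℕ) [hp : Fact p.Prime]

/-! ### §1 The class-agnostic consumer: exact leading term + the `T = 0` divisibility ⟹ the lower half -/

/-- **Core (rank `0`, any prime `p`).** For `E = W` globally minimal with `ord_{s=1} L(E,s) = 0`: the
typed inputs `CycLeadingTermDvdAt W p` ("`L(E,1)/Ω_E ∣ g(0)` for every `g ∈ char X(E/ℚ_∞)`") and
`ExactLeadingTermAt W p` (some `g ∈ char X(E/ℚ_∞)` has `g(0)·#E(ℚ)² = u·#Ш(p)·∏_{ν≠p} c_ν`), with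
Gross–Zagier–Kolyvagin (`hGZK`: `E(ℚ)`, `Ш` finite; `#Ш_an = (L(E,1)/Ω_E)·#E(ℚ)²/∏ c_ν`) and
modularity (`hmod`: `L(E,1) ≠ 0`), give `#Ш_an(E) = q ∈ ℚ` with
**`ord_p q + ord_p c_p(E) ≤ ord_p #Ш(E)`** (torsion and the Tamagawa numbers away from `p` cancel
exactly; the local Tamagawa number AT `p` survives with the sign that STRENGTHENS the lower half).
[cite: Delbourgo1998, Prop. 4 (p. 144) and Main Conjecture (p. 151) (shapes of the two typed inputs)]
[cite: Miller2011LMS, Def. 1.1] -/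
theorem shaAn_le_shaOrder_of_cycLeadingTermDvd_of_exact
    (hGZK : rank_eq_analyticRank_of_analyticRank_le_one) (hmod : hasEntireLFunction_rat)
    (hr : W.analyticRank = 0) (hDvd : CycLeadingTermDvdAt W p) (hX : ExactLeadingTermAt W p) :
    ∃ q : ℚ, shaAn W = (q : ℂ) ∧
      padicValRat p q +
          padicValNat p (W.tamagawaNumberAt ((primesEquiv (R := 𝓞 ℚ)).symm ⟨p, hp.out⟩)) ≤
        (padicValNat p W.shaOrder : ℤ) := by
  classical
  have hpP : p.Prime := hp.out
  set v₀ : HeightOneSpectrum (𝓞 ℚ) := (primesEquiv (R := 𝓞 ℚ)).symm ⟨p, hp.out⟩ with hv₀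
  -- rank 0: `L(E,1) ≠ 0`, `E(ℚ)` and `Ш` finite
  have hL : W.entireLFunction 1 ≠ 0 := (W.analyticRank_eq_zero_iff_holds (hmod W)).mp hr
  obtain ⟨hmw, hfin⟩ := hGZK W (by rw [hr]; exact zero_le_one)
  have hmw0 : W.mordellWeilRank = 0 := by rw [hmw, hr]
  haveI : Finite W.sha := hfin
  haveI hE : Finite W.toAffine.Point := W.finite_point_of_rank_zero hmw0
  -- the cyclotomic setting and `X(E/ℚ_∞)`
  obtain ⟨κ, hκ, γ, hγ, hγ'⟩ := exists_isCyclotomic_isTopGenerator_isCyclotomicVariable_holds p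
  obtain ⟨D⟩ := W.nonempty_selmerDualData_holds κ γ hγ
  -- the exact leading term: `g(0) · T² = u · #Ш(p) · P'`
  obtain ⟨g, hgmem, u, hgeq⟩ := hX κ γ hκ hγ D
  -- the `T = 0` divisibility at that `g`: `g(0) = z · q`, `L(E,1) = q · Ω_E`
  obtain ⟨z, q, hLq, hg0⟩ := hDvd κ γ hκ hγ hγ' D g hgmem
  -- `#Ш_an = q · #E(ℚ)² / ∏ c_ν`
  have hΩ : (W.realPeriodRat : ℂ) ≠ 0 := by exact_mod_cast W.realPeriodRat_pos_holds.ne'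
  have hq' : W.entireLFunction 1 / (W.realPeriodRat : ℂ) = (q : ℂ) := by
    rw [hLq, mul_div_cancel_right₀ _ hΩ]
  obtain ⟨-, -, -, hshaAn⟩ := Wuthrich2014.shaAn_eq_of_L_one_div_eq hGZK W hL hq'
  have hq0 : q ≠ 0 := by
    intro h0
    apply hL
    rw [hLq, h0, Rat.cast_zero, zero_mul]
  -- names for the arithmetic quantities
  set T : ℕ := Nat.card W.toAffine.Point with hT
  set c : ℕ := W.tamagawaNumberAt v₀ with hc
  set S : ℕ := Nat.card (AddCommGroup.primaryComponent W.sha p) with hS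
  set P' : ℕ := ∏ᶠ v : HeightOneSpectrum (𝓞 ℚ),
    (if (p : 𝓞 ℚ) ∈ v.asIdeal then 1 else W.tamagawaNumberAt v) with hP'
  have hT0 : T ≠ 0 := by rw [hT]; exact Nat.card_pos.ne'
  have hS0 : S ≠ 0 := by rw [hS]; exact Nat.card_pos.ne'
  have hPsplit : W.tamagawaProduct = c * P' := tamagawaProduct_eq_tamagawaNumberAt_mul_finprod W p
  have hPpos : 0 < W.tamagawaProduct := W.tamagawaProduct_pos_holds
  have hc0 : c ≠ 0 := fun h ↦ by rw [hPsplit, h, zero_mul] at hPpos; exact lt_irrefl 0 hPpos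
  have hP'0 : P' ≠ 0 := fun h ↦ by rw [hPsplit, h, mul_zero] at hPpos; exact lt_irrefl 0 hPpos
  have hvP : padicValNat p W.tamagawaProduct = padicValNat p c + padicValNat p P' := by
    rw [hPsplit, padicValNat.mul hc0 hP'0]
  have hsha : padicValNat p S = padicValNat p W.shaOrder := by
    rw [hS]
    unfold WeierstrassCurve.shaOrder
    exact padicValNat_card_addPrimaryComponent p
  -- the identity in `ℤ_p`, read in `ℚ_p`
  set g0 : ℚ_[p] := ((PowerSeries.constantCoeff g : ℤ_[p]) : ℚ_[p]) with hg0def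
  have hqQ : ((q : ℚ) : ℚ_[p]) ≠ 0 := by exact_mod_cast hq0
  have hTQ : ((T : ℕ) : ℚ_[p]) ≠ 0 := by exact_mod_cast hT0
  have hSQ : ((S : ℕ) : ℚ_[p]) ≠ 0 := by exact_mod_cast hS0
  have hP'Q : ((P' : ℕ) : ℚ_[p]) ≠ 0 := by exact_mod_cast hP'0
  have hkey : g0 * ((T : ℕ) : ℚ_[p]) ^ 2 =
      ((u : ℤ_[p]) : ℚ_[p]) * ((S : ℕ) : ℚ_[p]) * ((P' : ℕ) : ℚ_[p]) := by
    have h := congrArg ((↑) : ℤ_[p] → ℚ_[p]) hgeq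
    push_cast at h
    rw [hg0def]
    exact h
  have hrhs0 : ((u : ℤ_[p]) : ℚ_[p]) * ((S : ℕ) : ℚ_[p]) * ((P' : ℕ) : ℚ_[p]) ≠ 0 :=
    mul_ne_zero (mul_ne_zero (coe_units_ne_zero p u) hSQ) hP'Q
  have hzQ : ((z : ℤ_[p]) : ℚ_[p]) ≠ 0 := by
    intro h0
    rw [hg0, h0, zero_mul, zero_mul] at hkey
    exact hrhs0 hkey.symm
  have hg0ne : g0 ≠ 0 := by
    rw [hg0]
    exact mul_ne_zero hzQ hqQ
  have hvg0 : g0.valuation = ((z : ℤ_[p]) : ℚ_[p]).valuation + padicValRat p q := by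
    rw [hg0, Padic.valuation_mul hzQ hqQ, Padic.valuation_ratCast]
  have hval := congrArg Padic.valuation hkey
  rw [Padic.valuation_mul hg0ne (pow_ne_zero 2 hTQ), Padic.valuation_pow, Padic.valuation_natCast,
    hvg0, Padic.valuation_mul (mul_ne_zero (coe_units_ne_zero p u) hSQ) hP'Q,
    Padic.valuation_mul (coe_units_ne_zero p u) hSQ, valuation_coe_units_eq_zero, zero_add,
    Padic.valuation_natCast, Padic.valuation_natCast, hsha] at hval
  have hzval : 0 ≤ (((z : ℤ_[p]) : ℚ_[p])).valuation := PadicInt.valuation_coe_nonneg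
  -- (**) `ord_p q + 2 ord_p T ≤ ord_p #Ш + ord_p P'`
  have hineq : padicValRat p q + 2 * (padicValNat p T : ℤ) ≤
      (padicValNat p W.shaOrder : ℤ) + padicValNat p P' := by
    simp only [Nat.cast_ofNat] at hval
    linarith
  -- conclusion: `ord_p(q T²/∏ c_ν) + ord_p c_p = ord_p q + 2 ord_p T − ord_p P' ≤ ord_p #Ш`
  refine ⟨q * (T : ℚ) ^ 2 / (W.tamagawaProduct : ℚ), ?_, ?_⟩
  · rw [hshaAn]
  · have hTq : (T : ℚ) ≠ 0 := by exact_mod_cast hT0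
    have hPq : (W.tamagawaProduct : ℚ) ≠ 0 := by exact_mod_cast hPpos.ne'
    rw [padicValRat.div (mul_ne_zero hq0 (pow_ne_zero 2 hTq)) hPq,
      padicValRat.mul hq0 (pow_ne_zero 2 hTq), padicValRat.pow, padicValRat.of_nat,
      padicValRat.of_nat, hvP]
    simp only [Nat.cast_ofNat, Nat.cast_add]
    linarith

/-- **The LOWER half from the `T = 0` divisibility and the exact leading term** (rank `0`, any `p`):
in the setting of `shaAn_le_shaOrder_of_cycLeadingTermDvd_of_exact`, `Typed.MissingLowerBoundAt W p`
(`ord_p #Ш_an(E) ≤ ord_p #Ш(E)`; the slack `ord_p c_p(E) ≥ 0` is dropped).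
[cite: Delbourgo1998, Prop. 4 (p. 144) and Main Conjecture (p. 151) (shapes)] [cite: Miller2011LMS, Def. 1.1] -/
theorem missingLowerBoundAt_of_cycLeadingTermDvd_of_exact
    (hGZK : rank_eq_analyticRank_of_analyticRank_le_one) (hmod : hasEntireLFunction_rat)
    (hr : W.analyticRank = 0) (hDvd : CycLeadingTermDvdAt W p) (hX : ExactLeadingTermAt W p) :
    MissingLowerBoundAt W p := by
  obtain ⟨q, hq, hle⟩ := shaAn_le_shaOrder_of_cycLeadingTermDvd_of_exact W p hGZK hmod hr hDvd hX
  refine ⟨q, hq, ?_⟩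
  have h0 : (0 : ℤ) ≤ padicValNat p (W.tamagawaNumberAt ((primesEquiv (R := 𝓞 ℚ)).symm ⟨p, hp.out⟩)) :=
    Nat.cast_nonneg _
  linarith

/-! ### §2 The (M) locus: the exact leading term is Delbourgo's theorem, so the lower half needs ONLY the `T = 0` divisibility -/

/-- **On the (M) locus in analytic rank `0`, `ExactLeadingTermAt W p` holds** (Delbourgo 1998
Prop. 4 + §2.2 Lemma (ii), named fact `hDelX`; `E(ℚ)`, `Ш` finite by GZK). `W` globally minimal,
`p ≠ 2` additive with `ord_p j < 0`. [cite: Delbourgo1998, Prop. 4 (p. 144), §2.2 Lemma (ii) (p. 139)] -/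
theorem exactLeadingTermAt_of_potMult
    (hDelX : Delbourgo1998.prop4_rankZero_constantCoeff_eq_unit_mul_of_potMult)
    (hGZK : rank_eq_analyticRank_of_analyticRank_le_one)
    (hp2 : p ≠ 2) (hadd : Addv W p) (hj : padicValRat p W.j < 0) (hr : W.analyticRank = 0) :
    ExactLeadingTermAt W p := by
  intro κ γ hκ hγ D
  obtain ⟨hmw, hfin⟩ := hGZK W (by rw [hr]; exact zero_le_one)
  have hmw0 : W.mordellWeilRank = 0 := by rw [hmw, hr]
  haveI : Finite W.sha := hfin
  haveI hE : Finite W.toAffine.Point := W.finite_point_of_rank_zero hmw0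
  obtain ⟨-, g, hgmem, -, u, hgeq⟩ := hDelX W p hp2 hadd hj hr hfin hE κ γ hκ hγ D
  exact ⟨g, hgmem, u, hgeq⟩

/-- **(M) locus, rank `0`, any odd `p`: the LOWER half from the `T = 0` main-conjecture divisibility
ALONE.** For `E = W` globally minimal, `p ≠ 2` a prime of additive, potentially multiplicative
reduction (`ord_p j < 0`), `r_an = 0`: `CycLeadingTermDvdAt W p` + Delbourgo 1998 Prop. 4 / Lemma (ii)
(`hDelX`) + GZK + modularity ⟹ `ord_p #Ш_an(E) ≤ ord_p #Ш(E)`. No image, Tamagawa, Manin or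
certificate hypothesis. [cite: Delbourgo1998, Prop. 4 (p. 144), §2.2 Lemma (ii) (p. 139), Main Conjecture (p. 151)] -/
theorem missingLowerBoundAt_rankZero_of_potMult_of_cycLeadingTermDvd
    (hDelX : Delbourgo1998.prop4_rankZero_constantCoeff_eq_unit_mul_of_potMult)
    (hGZK : rank_eq_analyticRank_of_analyticRank_le_one) (hmod : hasEntireLFunction_rat)
    (hp2 : p ≠ 2) (hadd : Addv W p) (hj : padicValRat p W.j < 0) (hr : W.analyticRank = 0)
    (hDvd : CycLeadingTermDvdAt W p) : MissingLowerBoundAt W p :=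
  missingLowerBoundAt_of_cycLeadingTermDvd_of_exact W p hGZK hmod hr hDvd
    (exactLeadingTermAt_of_potMult W p hDelX hGZK hp2 hadd hj hr)

/-- **(M) locus, rank `0`: the sharper inequality `ord_p #Ш_an(E) + ord_p c_p(E) ≤ ord_p #Ш(E)`**
(so on these rows `p ∣ c_p(E)` is incompatible with `BSD(E,p)` plus the upper half — consistent with
Kodaira–Néron: `c_p ≤ 4`, and at `p = 3` type `I_n^*` has `c_3 ∈ {2, 4}`).
[cite: Delbourgo1998, Prop. 4 (p. 144), §2.2 Lemma (ii) (p. 139), Main Conjecture (p. 151)] -/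
theorem shaAn_le_shaOrder_rankZero_of_potMult_of_cycLeadingTermDvd
    (hDelX : Delbourgo1998.prop4_rankZero_constantCoeff_eq_unit_mul_of_potMult)
    (hGZK : rank_eq_analyticRank_of_analyticRank_le_one) (hmod : hasEntireLFunction_rat)
    (hp2 : p ≠ 2) (hadd : Addv W p) (hj : padicValRat p W.j < 0) (hr : W.analyticRank = 0)
    (hDvd : CycLeadingTermDvdAt W p) :
    ∃ q : ℚ, shaAn W = (q : ℂ) ∧
      padicValRat p q +
          padicValNat p (W.tamagawaNumberAt ((primesEquiv (R := 𝓞 ℚ)).symm ⟨p, hp.out⟩)) ≤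
        (padicValNat p W.shaOrder : ℤ) :=
  shaAn_le_shaOrder_of_cycLeadingTermDvd_of_exact W p hGZK hmod hr hDvd
    (exactLeadingTermAt_of_potMult W p hDelX hGZK hp2 hadd hj hr)

variable {W p}

/-- **X4(M) (= X4 ∧ additive potentially multiplicative; `p` odd by definition, `3` included),
`r_an = 0`: the LOWER half `ord_p #Ш_an ≤ ord_p #Ш` from the typed `T = 0` divisibility
`CycLeadingTermDvdAt W p` alone** (other inputs: Delbourgo 1998 Prop. 4 / Lemma (ii) `hDelX`, GZK,
modularity). NO image, Tamagawa, Manin or certificate hypothesis. X4(M) stays CONSTRUCTION-SHAPED;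
the typed input is NOT in print. [cite: Delbourgo1998, Prop. 4 (p. 144), §2.2 Lemma (ii) (p. 139), Main Conjecture (p. 151)] -/
theorem _root_.Summit.BirchSwinnertonDyer.Rank1Residual.AdditivePotMult.ClassX4M.missingLowerBoundAt_rankZero_of_cycLeadingTermDvd
    (hDelX : Delbourgo1998.prop4_rankZero_constantCoeff_eq_unit_mul_of_potMult)
    (hGZK : rank_eq_analyticRank_of_analyticRank_le_one) (hmod : hasEntireLFunction_rat)
    (hX : AdditivePotMult.ClassX4M W p) (hr : W.analyticRank = 0) (hDvd : CycLeadingTermDvdAt W p) :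
    MissingLowerBoundAt W p :=
  missingLowerBoundAt_rankZero_of_potMult_of_cycLeadingTermDvd W p hDelX hGZK hmod hX.1.1 hX.2.1
    hX.2.2 hr hDvd

/-- **X3♯(M) (= X3 ∧ additive potentially multiplicative ∧ `p ≠ 2`), `r_an = 0`: the LOWER half from
the typed `T = 0` divisibility alone** (Delbourgo's theorems carry no image hypothesis, so the
reducible class is covered verbatim). X3♯(M) stays CONSTRUCTION-SHAPED.
[cite: Delbourgo1998, Prop. 4 (p. 144), §2.2 Lemma (ii) (p. 139), Main Conjecture (p. 151)] -/
theorem _root_.Summit.BirchSwinnertonDyer.Rank1Residual.AdditivePotMult.ClassX3M.missingLowerBoundAt_rankZero_of_cycLeadingTermDvd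
    (hDelX : Delbourgo1998.prop4_rankZero_constantCoeff_eq_unit_mul_of_potMult)
    (hGZK : rank_eq_analyticRank_of_analyticRank_le_one) (hmod : hasEntireLFunction_rat)
    (hX : AdditivePotMult.ClassX3M W p) (hr : W.analyticRank = 0) (hDvd : CycLeadingTermDvdAt W p) :
    MissingLowerBoundAt W p :=
  missingLowerBoundAt_rankZero_of_potMult_of_cycLeadingTermDvd W p hDelX hGZK hmod hX.2.2 hX.2.1.1
    hX.2.1.2 hr hDvd

/-! ### §3 The (G)-ordinary locus: the lower half from the `T = 0` divisibility AND the exact leading term -/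

/-- **X4♯(G-ord) (any defect), `r_an = 0`: the LOWER half from `CycLeadingTermDvdAt W p` and
`ExactLeadingTermAt W p`** (both typed; GZK, modularity). The second input is Delbourgo Prop. 4 with
the `H¹`-factor of `p`-part `1` (module docstring). X4♯(G-ord) stays CONSTRUCTION-SHAPED.
[cite: Delbourgo1998, Prop. 4 (p. 144), Main Conjecture (p. 151) (shapes)] -/
theorem ClassX4Gord.missingLowerBoundAt_rankZero_of_cycLeadingTermDvd_of_exact
    (hGZK : rank_eq_analyticRank_of_analyticRank_le_one) (hmod : hasEntireLFunction_rat)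
    (_hX : ClassX4Gord W p) (hr : W.analyticRank = 0) (hDvd : CycLeadingTermDvdAt W p)
    (hEx : ExactLeadingTermAt W p) : MissingLowerBoundAt W p :=
  missingLowerBoundAt_of_cycLeadingTermDvd_of_exact W p hGZK hmod hr hDvd hEx

/-- **X3♯(G-ord) (any defect), `r_an = 0`: the LOWER half from `CycLeadingTermDvdAt W p` and
`ExactLeadingTermAt W p`.** X3♯(G-ord) stays CONSTRUCTION-SHAPED.
[cite: Delbourgo1998, Prop. 4 (p. 144), Main Conjecture (p. 151) (shapes)] -/
theorem ClassX3Gord.missingLowerBoundAt_rankZero_of_cycLeadingTermDvd_of_exact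
    (hGZK : rank_eq_analyticRank_of_analyticRank_le_one) (hmod : hasEntireLFunction_rat)
    (_hX : ClassX3Gord W p) (hr : W.analyticRank = 0) (hDvd : CycLeadingTermDvdAt W p)
    (hEx : ExactLeadingTermAt W p) : MissingLowerBoundAt W p :=
  missingLowerBoundAt_of_cycLeadingTermDvd_of_exact W p hGZK hmod hr hDvd hEx

end Summit.BirchSwinnertonDyer.Rank1Residual.Additive

end
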